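import Summits.BirchSwinnertonDyer.BirchSwinnertonDyer.Theorems.SignedLowerHalvesSmallImageLowerHalfBothSignsRttF1CMRealityPrefix
import Literature.NumberTheory.ComplexMultiplication.CMOrderPrimeIdealTwoElement
import Literature.NumberTheory.EllipticCurves.HeckeLFunctionEqLSeriesOfLocalFactors
import HarnessLib

/-!
# Route `SignedLowerHalves`, crux L `SmallImageLowerHalfBothSigns` (stmt-BirchSwinnertonDyer-23599), line `rtt_w3` v43 — row S4‴ (`stub_junctionRecipValues_ns`):
# THE CM-REALITY PREMISE OF THE CLOSING, DISCHARGED FROM THE PREFIX (two-sided form, for the LEAD's paste)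

WIDTH seat `bsd-line-slh-p3-w3` g30 under LEAD `cruxlead-stmt-BirchSwinnertonDyer-23599` g15 (cell `bsd-ssimc`; LEAD 17:25Z: «discharge hψc inside your closing with p829728;
keep h𝔣c and 𝔪 ∣ 𝔣 as premises»). Helper `--supports stmt-BirchSwinnertonDyer-23599`. THEOREMS ONLY; no definition, no named fact, no instance, no `sorry`.

WHAT. The closing `junctionRecipValues_of_F1` (p829928) takes the two-sided CM-reality premise `hψc : ∀ w, 𝔪 ∤ 𝔭_w → 𝔪 ∤ 𝔭_{c•w} → ψ(c • w) = conj (ψ w)`.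
honda g31's `SmallImageRttF1Bridge.apply_smul_eq_conj_of_prefix` (p829728) proves `ψ(c • w) = conj (ψ w)` from the v43 prefix ALONE (`hK2, htc, σK, h𝔪, hψ, hψpow`) at every
prime `w` over a rational `ℓ ∤ |d_K|·N𝔪`. ★ `hψc_of_prefix`: the two meet under ONE cheap SUPPORT clause `hd𝔪 : ∀ w, d_K ∈ 𝔭_w → 𝔪 ≤ 𝔭_w` («every prime dividing `d_K`
divides `𝔪`» — true for the producer's `𝔪 = (t)`, `t = d_K·B^m`; the trivial producer′ export of honda g31/g32) and `c ≠ 1`: for `w` with `𝔪 ∤ 𝔭_w` and `𝔪 ∤ 𝔭_{c•w}` the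
prime `ℓ` below `w` divides neither `N𝔪` (a maximal ideal above `𝔪 + (ℓ)` is a prime over `ℓ` containing `𝔪`, hence `w` or `c • w` — `eq_or_eq_smul_of_natCast_mem`,
`NumberRing.dvd_absNorm_iff_sup_span_ne_top`) nor `d_K` (`d_K ∈ (ℓ) ⊆ 𝔭_w` would give `𝔪 ⊆ 𝔭_w` by `hd𝔪`). USE (LEAD paste): in the argument list of
`junctionRecipValues_of_F1` replace `hψc` by `(SmallImageRttReciprocity.hψc_of_prefix hK2 σK cK hcK h𝔪 hψ hψpow hd𝔪)` — the closing's road premises become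
F1, hBad, `𝔪 ∣ 𝔣`, `hd𝔪`, `cK ≠ 1`, `cK • 𝔣 = 𝔣` (a `₂` restatement of the closing is refused by the dedup gate as a restatement, hence this lemma-only file).
HONEST FRAMING: S4‴, crux L, crux M and BSD remain OPEN; BSD is proved for NO curve. References: [Marcus2018] Ch. 3 Thm. 25; [NeukirchANT1999] Ch. VII §6; [Cohen1993] §4.7.2.
-/

set_option autoImplicit false
set_option linter.dupNamespace false -- D-0017: single-problem summit, the namespace repeats the problem name by design
noncomputable section

open scoped Classical NumberField ComplexConjugate Pointwise
open NumberField IsDedekindDomain Field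

namespace Summit.BirchSwinnertonDyer.BirchSwinnertonDyer.Theorems.SmallImageRttReciprocity

open Literature.NumberTheory.EllipticCurves Literature.NumberTheory.GaloisRepresentations Literature.NumberTheory.LFunctions

section Reality

variable {K : Type} [Field K] [NumberField K] [IsTotallyComplex K]

/-- ★ **CM-reality off `𝔪`, two-sided, from the prefix** under the support clause «every prime dividing `d_K` divides `𝔪`»: for `w` with `𝔪 ∤ 𝔭_w`, `𝔪 ∤ 𝔭_{c • w}`, `ψ(c • w) = conj (ψ w)`.
The prime `ℓ` below `w` divides neither `N𝔪` (a maximal ideal above `𝔪 + (ℓ)` is `w` or `c • w`) nor `d_K` (`d_K ∈ (ℓ) ≤ 𝔭_w`, then `𝔪 ≤ 𝔭_w` by the support clause), so honda's `apply_smul_eq_conj_of_prefix` applies.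
[cite: Marcus2018, Ch. 3 Thm. 25] [cite: NeukirchANT1999, Ch. VII §6 Def. (6.1)] [cite: Cohen1993, §4.7.2 Lemma 4.7.9] -/
theorem hψc_of_prefix (hK2 : Module.finrank ℚ K = 2) (σK : K →+* ℂ) (cK : K ≃ₐ[ℚ] K) (hcK : cK ≠ 1) {𝔪 : Ideal (𝓞 K)} (h𝔪 : 𝔪 ≠ ⊥)
    {ψ : HeightOneSpectrum (𝓞 K) → ℂ} (hψ : IsGrossencharakter 𝔪 (embType σK) (embTypeConj σK) ψ)
    (hψpow : ∀ n : ℕ, Odd n → n.Coprime ((discr K).natAbs * Ideal.absNorm 𝔪) →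
      idealPow K ψ (Ideal.span {(n : 𝓞 K)}) = (jacobiSym (discr K) n : ℂ) * (n : ℂ) ^ (2 - 1))
    (hd𝔪 : ∀ w : HeightOneSpectrum (𝓞 K), ((NumberField.discr K : ℤ) : 𝓞 K) ∈ w.asIdeal → 𝔪 ≤ w.asIdeal) :
    ∀ w : HeightOneSpectrum (𝓞 K), ¬ 𝔪 ≤ w.asIdeal → ¬ 𝔪 ≤ (cK • w).asIdeal → ψ (cK • w) = conj (ψ w) := by
  intro w hw hcw
  -- the rational prime below `w`
  set v : HeightOneSpectrum (𝓞 ℚ) := w.under (𝓞 ℚ) with hvdef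
  set ℓ : ℕ := (Rat.HeightOneSpectrum.primesEquiv v : ℕ) with hℓdef
  have hℓ : ℓ.Prime := (Rat.HeightOneSpectrum.primesEquiv v).2
  have hℓw : (ℓ : 𝓞 K) ∈ w.asIdeal := (under_eq_iff_natCast_primesEquiv_mem w v).mp rfl
  refine SmallImageRttF1Bridge.apply_smul_eq_conj_of_prefix hK2 σK cK hcK h𝔪 hψ hψpow hℓ (fun hdvd ↦ ?_) hℓw
  rcases (Nat.Prime.dvd_mul hℓ).mp hdvd with hd | hN
  · -- `ℓ ∣ d_K`: then `𝔪 ≤ (d_K) ≤ (ℓ) ≤ 𝔭_w`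
    obtain ⟨k, hk⟩ := Int.ofNat_dvd_left.mpr hd
    refine hw (hd𝔪 w ?_)
    have h1 : ((NumberField.discr K : ℤ) : 𝓞 K) = (ℓ : 𝓞 K) * (k : 𝓞 K) := by rw [hk]; push_cast; ring
    rw [h1]
    exact w.asIdeal.mul_mem_right _ hℓw
  · -- `ℓ ∣ N𝔪`: a maximal ideal above `𝔪 + (ℓ)` is a prime over `ℓ` containing `𝔪`, hence `w` or `c • w`
    have hne : 𝔪 ⊔ Ideal.span {(ℓ : 𝓞 K)} ≠ ⊤ := (Literature.NumberTheory.ComplexMultiplication.NumberRing.dvd_absNorm_iff_sup_span_ne_top hℓ 𝔪).mp hN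
    obtain ⟨M', hM', hle⟩ := Ideal.exists_le_maximal _ hne
    have hℓM : (ℓ : 𝓞 K) ∈ M' := hle (Ideal.mem_sup_right (Ideal.mem_span_singleton_self _))
    have hM'0 : M' ≠ ⊥ := by
      intro h0
      rw [h0, Ideal.mem_bot] at hℓM
      exact hℓ.ne_zero (by exact_mod_cast hℓM)
    set u : HeightOneSpectrum (𝓞 K) := ⟨M', hM'.isPrime, hM'0⟩
    have h𝔪u : 𝔪 ≤ u.asIdeal := le_sup_left.trans hle
    rcases SmallImageRttF1Bridge.eq_or_eq_smul_of_natCast_mem hK2 cK hcK hℓ hℓw (u := u) hℓM with h | h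
    · exact hw (h ▸ h𝔪u)
    · exact hcw (h ▸ h𝔪u)

end Reality

end Summit.BirchSwinnertonDyer.BirchSwinnertonDyer.Theorems.SmallImageRttReciprocity

end
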